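import Summits.QuantumFields.YangMills.Theorems.IR.AfPincerUcFormat
import Summits.QuantumFields.YangMills.Theorems.IR.Negative.TypShellCondFalseFixedMesh
import Summits.QuantumFields.YangMills.Theorems.BalabanLadderIRAfOnsetLargeUnit

/-!
# Crux `IR` (stmt-QuantumFields-19354), line `af-pincer`, slot `af-pincer-Uc`: kernel anatomy of the X-stub
# `stub_afOnsetUc : AFToOnsetUKPc` (seat ym-19354-afpincer-s2)

Helper file (`--supports stmt-QuantumFields-19354`) about the REGISTERED statement `AfPincerUc.AFToOnsetUKPc` and its onset
`AfPincerUc.mixOnsetUc` (tree constants since `Theorems/IR/AfPincerUcFormat.lean`, = slot sha16 b6e69d9662b5b07a §A–§C).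
Nothing here closes the stub; what is proved, sorry-free:

* §X1 `afToOnsetUKPc_clause_of_bddOnset` — the X-clause at `(G, r, n, ε, δ)` holds on every tail where `b⋆^c(β)` is
  bounded (large-unit lemma `AfOnset.afToOnset_clause_of_bddOnset`: `Q2(θv, v) = O(1/s)` uniformly in `β, L`);
  `afToOnsetUKPc_iff_unbounded_regime` — hence `AFToOnsetUKPc` is EQUIVALENT to its restriction to the parameter points
  where `b⋆^c` is unbounded on every tail.
* §X2 the slice `δ ≥ 1` PROVED: the EMPTY typical class witnesses `TypShellCondUKPc` at every mesh (`ClauseIAll` is void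
  because the corner shell cell `(2n+1, …, 2n+1)` lies outside every `Y ⊆ windowCells n`; (ii)/(iii) read `prob ≤ 1 ≤ δ^#F`),
  so `mixOnsetUc = 1` and the X-clause holds (`typShellCondUKPc_of_one_le`, `mixOnsetUc_eq_one_of_one_le`,
  `afToOnsetUKPc_clause_of_one_le`).  Content of X^{Uc} therefore lives at `δ < 1` only.
* §X3 monotonicity in the rarity budget: `typShellCondUKPc_mono_delta`, `mixOnsetUc_anti_delta` (`0 ≤ δ ≤ δ'` ⇒
  `b⋆^c(δ') ≤ b⋆^c(δ)` on non-empty mix sets), `afToOnsetUKPc_clause_mono_delta` (the X-clause at a SMALLER budget implies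
  it at a larger one, given the format is met at the smaller budget eventually — e.g. under `OnsetMixingTypicalUKPc`);
  generic form `afToOnset_clause_of_stronger_format` (X transfers from a stronger format to a weaker one), instance
  `afToOnset_clauseT_of_clauseUc` (Uc ⇒ the registered T format `OnsetFormats.TypShellCond`).
* §X4 the kernel form of R66 for X: for a representation with a charged scalar centre element (e.g. `SU(2)` fundamental),
  `0 ≤ ε` with `16 ε < ‖1 − c‖` and `δ < 1/(4 · #windowCellsPlus n)`, for every bound `B` eventually
  `b⋆^c(β) = 0 ∨ B < b⋆^c(β)` (`mixOnsetUc_eq_zero_or_lt`, from the tree's `FixedMesh.typOnsetFloor` through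
  `typShellCond_of_UKPc`): at such points the bounded-onset regime of §X1 is available only through `b⋆^c = 0` (format
  unmet), so wherever the supplier `stub_onsetUc` delivers the format, X^{Uc} is asked in the unbounded regime —
  «mixing follows interaction» (owner `XT-ANATOMY-g27.md` F1), whose polynomial part is `AfOnset.afToOnset_clause_of_polyOnset`
  (`Theorems/BalabanLadderIRAfOnsetLatticeAF`) and whose exponential part is NOT claimed here.

HONEST FRAMING: elementary; nothing about Yang–Mills is asserted; one open stub of one open gap-crux of a CONDITIONAL chain.
-/

set_option autoImplicit false

noncomputable section

open Filter Topology MeasureTheory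
open scoped SchwartzMap
open Literature.MathematicalPhysics.QuantumFieldTheory Literature.MathematicalPhysics.QuantumLattice
open Summit.QuantumFields.YangMills.Cruxes.OSLegsFromFemtoAndGap.DlrCollarTransfer (GapInUnits LowerBounds Q2)
open Summit.QuantumFields.YangMills.Cruxes.IR.Tempered (cellEdges windowCells regionEdges)
open Summit.QuantumFields.YangMills.Cruxes.IR.ShellTempered (windowCellsPlus)
open Summit.QuantumFields.YangMills.Cruxes.IR.CellTempered.Engine (shiftFrame cellEdges_shiftFrame)

/-! ## §X The X-stub `stub_afOnsetUc : AFToOnsetUKPc` — kernel anatomy (seat ym-19354-afpincer-s2)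

What is proved here, sorry-free, about the REGISTERED statement `AFToOnsetUKPc` and its onset `mixOnsetUc`:

* §X1 `afToOnsetUKPc_clause_of_bddOnset` — the X-clause at `(G, r, n, ε, δ)` holds on every tail where `b⋆^c(β)` is
  bounded (large-unit lemma `AfOnset.afToOnset_clause_of_bddOnset`, tree); `afToOnsetUKPc_iff_unbounded_regime` — hence
  `AFToOnsetUKPc` is EQUIVALENT to its restriction to the parameter points where `b⋆^c` is unbounded on every tail.
* §X2 the slice `δ ≥ 1` PROVED: the EMPTY typical class witnesses `TypShellCondUKPc` at every mesh (`ClauseIAll` is void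
  because the shell cell `(2n+1, …, 2n+1)` lies outside every `Y ⊆ windowCells n`; (ii)/(iii) read `prob ≤ 1 ≤ δ^#F`), so
  `mixOnsetUc = 1` and the X-clause holds (`typShellCondUKPc_of_one_le`, `mixOnsetUc_eq_one_of_one_le`,
  `afToOnsetUKPc_clause_of_one_le`).  Content of X^{Uc} therefore lives at `δ < 1` only.
* §X3 monotonicity in the rarity budget: `typShellCondUKPc_mono_delta`, `mixOnsetUc_anti_delta` (`δ ≤ δ'` ⇒
  `b⋆^c(δ') ≤ b⋆^c(δ)` on non-empty mix sets), `afToOnsetUKPc_clause_mono_delta` (the X-clause at a SMALLER budget implies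
  it at a larger one, given the format is met at the smaller budget eventually — e.g. under `OnsetMixingTypicalUKPc`);
  generic form `afToOnset_clause_of_stronger_format` (X transfers from a stronger format to a weaker one), instance
  `afToOnset_clauseT_of_clauseUc` (Uc ⇒ the registered T format `OnsetFormats.TypShellCond`).
* §X4 the kernel form of R66 for X: for a representation with a charged scalar centre element (e.g. `SU(2)` fundamental),
  admissible `ε` and `δ < 1/(4 · #windowCellsPlus n)`, for every bound `B` eventually `b⋆^c(β) = 0 ∨ B < b⋆^c(β)`
  (`mixOnsetUc_eq_zero_or_lt`, from the tree's `FixedMesh` floor `typOnsetFloor` through `typShellCond_of_UKPc`): the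
  bounded-onset regime of §X1 is void there unless the format is unmet, so X^{Uc}'s content is the unbounded regime —
  «mixing follows interaction» (owner `XT-ANATOMY-g27.md` F1), not claimed here.

HONEST FRAMING: elementary; nothing about Yang–Mills is asserted; one open stub of one open gap-crux of a CONDITIONAL chain.
-/

namespace Summit.QuantumFields.YangMills.Cruxes.IR.AfPincerUc

section XSide

variable {G : Type} [Group G] [TopologicalSpace G] [IsTopologicalGroup G] [CompactSpace G]
  [MeasurableSpace G] [BorelSpace G]

/-! ### §X1 The bounded-onset regime; reduction of `AFToOnsetUKPc` to the unbounded regime -/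

/-- **Bounded onset ⟹ the X-clause of `AFToOnsetUKPc` at `(G, r, n, ε, δ)`.**  If `b⋆^c(β) = mixOnsetUc r.ρ β n ε δ ≤ M`
for all `β ≥ β₀` then for every `v` supported at positive times and every `η > 0` there are `T, β₁` with
`β ≥ β₁ → s > 0 → T ≤ s · b⋆^c(β) → ∃ᶠ L, |Q2 G r β L s (θv) v| ≤ η` (tree `AfOnset.afToOnset_clause_of_bddOnset`:
`Q2(θv, v) = O(1/s)` uniformly in `β, L`).  Covers «format met at no mesh» (`b⋆^c = 0`). -/
theorem afToOnsetUKPc_clause_of_bddOnset (r : LatticeRep G) (n : ℕ) (ε δ : ℝ) {M : ℕ} {β₀ : ℝ}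
    (hbdd : ∀ β : ℝ, β₀ ≤ β → mixOnsetUc r.ρ β n ε δ ≤ M)
    (v : 𝓢(EuclideanSpace ℝ (Fin 4), ℝ)) (hv : tsupport v ⊆ {y : EuclideanSpace ℝ (Fin 4) | 0 < y 0})
    {η : ℝ} (hη : 0 < η) :
    ∃ T β₁ : ℝ, ∀ β : ℝ, β₁ ≤ β → ∀ s : ℝ, 0 < s → T ≤ s * (mixOnsetUc r.ρ β n ε δ : ℝ) →
      ∃ᶠ (L : ℕ) in atTop, |Q2 G r β L s (thetaTest 4 v) v| ≤ η :=
  AfOnset.afToOnset_clause_of_bddOnset r (fun β => mixOnsetUc r.ρ β n ε δ) hbdd v hv hη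

omit [MeasurableSpace G] [BorelSpace G] in
/-- **`AFToOnsetUKPc` reduces to the unbounded-onset regime**: the registered statement is EQUIVALENT to the same
statement asked only at the parameter points `(G, r, n, ε, δ)` where the onset `b⋆^c` is unbounded on every tail
(`∀ M β₀, ∃ β ≥ β₀, M < b⋆^c(β)`); at all other points the X-clause holds by `afToOnsetUKPc_clause_of_bddOnset`. -/
theorem afToOnsetUKPc_iff_unbounded_regime :
    AFToOnsetUKPc ↔
    ∀ (G : Type) [Group G] [TopologicalSpace G] [IsTopologicalGroup G] [CompactSpace G],
      IsCompactSimpleLieGroup G → letI : MeasurableSpace G := borel G; haveI : BorelSpace G := ⟨rfl⟩;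
      ∀ (r : LatticeRep G) (n : ℕ) (ε : ℝ), 1 ≤ n → 0 ≤ ε → ε * OnsetFormats.shellCount n ≤ 3 / 4 →
        ∀ δ : ℝ, 0 < δ → (∀ (M : ℕ) (β₀ : ℝ), ∃ β : ℝ, β₀ ≤ β ∧ M < mixOnsetUc r.ρ β n ε δ) →
        ∀ v : 𝓢(EuclideanSpace ℝ (Fin 4), ℝ), tsupport v ⊆ {y : EuclideanSpace ℝ (Fin 4) | 0 < y 0} →
          ∀ η : ℝ, 0 < η → ∃ T β₁ : ℝ, ∀ β : ℝ, β₁ ≤ β → ∀ s : ℝ, 0 < s →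
            T ≤ s * (mixOnsetUc r.ρ β n ε δ : ℝ) →
              ∃ᶠ (L : ℕ) in atTop, |Q2 G r β L s (thetaTest 4 v) v| ≤ η := by
  constructor
  · intro h G _ _ _ _ hG
    letI : MeasurableSpace G := borel G
    haveI : BorelSpace G := ⟨rfl⟩
    intro r n ε hn hε hM δ hδ _ v hv η hη
    exact h G hG r n ε hn hε hM δ hδ v hv η hη
  · intro h G _ _ _ _ hG
    letI : MeasurableSpace G := borel G
    haveI : BorelSpace G := ⟨rfl⟩
    intro r n ε hn hε hM δ hδ v hv η hη
    by_cases hb : ∃ (M : ℕ) (β₀ : ℝ), ∀ β : ℝ, β₀ ≤ β → mixOnsetUc r.ρ β n ε δ ≤ M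
    · obtain ⟨M, β₀, hbdd⟩ := hb
      exact afToOnsetUKPc_clause_of_bddOnset r n ε δ hbdd v hv hη
    · push Not at hb
      exact h G hG r n ε hn hε hM δ hδ hb v hv η hη

/-! ### §X2 The slice `δ ≥ 1`: the empty class witnesses format Uc at every mesh -/

omit [IsTopologicalGroup G] [CompactSpace G] [MeasurableSpace G] [BorelSpace G] in
/-- The corner shell cell `(2n+1, 2n+1, 2n+1, 2n+1)` lies in `windowCellsPlus n`. -/
theorem cornerShell_mem_windowCellsPlus (n : ℕ) :
    (fun _ : Fin 4 => (2 * (n : ℤ) + 1)) ∈ windowCellsPlus n := by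
  simp only [windowCellsPlus, Fintype.mem_piFinset, Finset.mem_Icc]
  intro i
  constructor <;> omega

omit [IsTopologicalGroup G] [CompactSpace G] [MeasurableSpace G] [BorelSpace G] in
/-- The corner shell cell is not a window cell. -/
theorem cornerShell_notMem_windowCells (n : ℕ) :
    (fun _ : Fin 4 => (2 * (n : ℤ) + 1)) ∉ windowCells n := by
  simp only [windowCells, Fintype.mem_piFinset, Finset.mem_Icc, not_forall]
  exact ⟨0, by omega⟩

/-- **For `δ ≥ 1` format Uc holds at EVERY mesh, witnessed by the EMPTY typical class**: `TypLocal` is trivial,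
`ClauseIAll` is void (its typicality premise asks `σ ∈ ∅` at the corner shell cell, which lies outside every
`Y ⊆ windowCells n`), and clauses (ii)-UKP / (iii) read `γ(…) ≤ 1 ≤ δ^#F` resp. `μ(…) ≤ 1 ≤ δ^#F` (probability
kernels / measures, tree `isProbabilityMeasure_ymSpecification` / `isProbabilityMeasure_wilsonMeasure`).  So the stub's
`∀ δ > 0` has content only for `δ < 1`. -/
theorem typShellCondUKPc_of_one_le (r : LatticeRep G) (β : ℝ) (b n : ℕ) (ε : ℝ) {δ : ℝ} (hδ : 1 ≤ δ) :
    TypShellCondUKPc r.ρ β b n ε δ := by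
  haveI : SecondCountableTopology G :=
    (r.continuous.isClosedEmbedding r.injective).isEmbedding.secondCountableTopology
  intro w _
  refine ⟨fun _ => ∅, ⟨fun _ => MeasurableSet.empty, fun _ => ?_⟩, ?_, ?_, ?_⟩
  · intro σ σ' _
    rfl
  · intro c₀ Y hY _ σ σ' htyp _ f _ _ _
    exfalso
    have h := htyp _ (cornerShell_mem_windowCellsPlus n)
      (fun hc => cornerShell_notMem_windowCells n (hY hc))
    exact h.1
  · intro F F' _ hF ζ _
    haveI := isProbabilityMeasure_ymSpecification r.ρ r.continuous β (regionEdges w F') ζ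
    calc (ymSpecification r.ρ β (regionEdges w F') ζ) {σ : LGConfig 4 G | ∀ c ∈ F, σ ∉ (∅ : Set (LGConfig 4 G))}
        ≤ 1 := prob_le_one
      _ = ENNReal.ofReal 1 := ENNReal.ofReal_one.symm
      _ ≤ ENNReal.ofReal (δ ^ F.card) := ENNReal.ofReal_le_ofReal (one_le_pow₀ hδ)
  · intro S _ F _ _
    haveI := isProbabilityMeasure_wilsonMeasure (d := 4) (L := 2 * S + 1) r.ρ r.continuous β
    calc (wilsonMeasure (d := 4) (L := 2 * S + 1) r.ρ β)
          {V : GaugeConfig 4 (2 * S + 1) G | ∀ c ∈ F, torusLift (2 * S + 1) V ∉ (∅ : Set (LGConfig 4 G))}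
        ≤ 1 := prob_le_one
      _ = ENNReal.ofReal 1 := ENNReal.ofReal_one.symm
      _ ≤ ENNReal.ofReal (δ ^ F.card) := ENNReal.ofReal_le_ofReal (one_le_pow₀ hδ)

/-- For `δ ≥ 1` the Uc mix set at every coupling is `{b | 1 ≤ b}`. -/
theorem fmtSet_typShellCondUKPc_of_one_le (r : LatticeRep G) (β : ℝ) (n : ℕ) (ε : ℝ) {δ : ℝ} (hδ : 1 ≤ δ) :
    fmtSet (fun β' b => TypShellCondUKPc r.ρ β' b n ε δ) β = {b : ℕ | 1 ≤ b} := by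
  ext b
  simp only [fmtSet, Set.mem_setOf_eq]
  exact ⟨fun h => h.1, fun h => ⟨h, typShellCondUKPc_of_one_le r β b n ε hδ⟩⟩

/-- **For `δ ≥ 1` the typical onset is `1` at every coupling.** -/
theorem mixOnsetUc_eq_one_of_one_le (r : LatticeRep G) (β : ℝ) (n : ℕ) (ε : ℝ) {δ : ℝ} (hδ : 1 ≤ δ) :
    mixOnsetUc r.ρ β n ε δ = 1 := by
  have hmem : (1 : ℕ) ∈ fmtSet (fun β' b => TypShellCondUKPc r.ρ β' b n ε δ) β :=
    ⟨le_rfl, typShellCondUKPc_of_one_le r β 1 n ε hδ⟩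
  have hle : mixOnsetUc r.ρ β n ε δ ≤ 1 := Nat.sInf_le hmem
  have hge : 1 ≤ mixOnsetUc r.ρ β n ε δ := (fmtOnset_spec _ β ⟨1, hmem⟩).1
  exact le_antisymm hle hge

/-- **The slice `δ ≥ 1` of `AFToOnsetUKPc`, PROVED** (no admissibility of `(n, ε)` needed): the onset is `≡ 1`, so the
bounded-onset lemma applies with `M = 1`. -/
theorem afToOnsetUKPc_clause_of_one_le (r : LatticeRep G) (n : ℕ) (ε : ℝ) {δ : ℝ} (hδ : 1 ≤ δ)
    (v : 𝓢(EuclideanSpace ℝ (Fin 4), ℝ)) (hv : tsupport v ⊆ {y : EuclideanSpace ℝ (Fin 4) | 0 < y 0})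
    {η : ℝ} (hη : 0 < η) :
    ∃ T β₁ : ℝ, ∀ β : ℝ, β₁ ≤ β → ∀ s : ℝ, 0 < s → T ≤ s * (mixOnsetUc r.ρ β n ε δ : ℝ) →
      ∃ᶠ (L : ℕ) in atTop, |Q2 G r β L s (thetaTest 4 v) v| ≤ η :=
  afToOnsetUKPc_clause_of_bddOnset r n ε δ (M := 1) (β₀ := 0)
    (fun β _ => (mixOnsetUc_eq_one_of_one_le r β n ε hδ).le) v hv hη

/-! ### §X3 Monotonicity in the rarity budget; transfer between formats -/

/-- Format Uc is MONOTONE in the rarity budget: clauses (ii)-UKP and (iii) only get weaker as `δ` grows (`0 ≤ δ ≤ δ'`). -/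
theorem typShellCondUKPc_mono_delta {N : ℕ} {ρ : G →* Matrix (Fin N) (Fin N) ℂ} {β : ℝ} {b n : ℕ} {ε δ δ' : ℝ}
    (hδ0 : 0 ≤ δ) (hδδ' : δ ≤ δ') (h : TypShellCondUKPc ρ β b n ε δ) : TypShellCondUKPc ρ β b n ε δ' := by
  intro w hw
  obtain ⟨Typ, hloc, hi, hii, hiii⟩ := h w hw
  refine ⟨Typ, hloc, hi, ?_, ?_⟩
  · intro F F' hFF' hF ζ hζ
    exact (hii F F' hFF' hF ζ hζ).trans (ENNReal.ofReal_le_ofReal (pow_le_pow_left₀ hδ0 hδδ' _))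
  · intro S hS F hF hin
    exact (hiii S hS F hF hin).trans (ENNReal.ofReal_le_ofReal (pow_le_pow_left₀ hδ0 hδδ' _))

/-- The typical onset is ANTITONE in the rarity budget on non-empty mix sets: `0 ≤ δ ≤ δ'` and the format met at
budget `δ` at some mesh give `b⋆^c(β, δ') ≤ b⋆^c(β, δ)`. -/
theorem mixOnsetUc_anti_delta {N : ℕ} (ρ : G →* Matrix (Fin N) (Fin N) ℂ) (β : ℝ) (n : ℕ) (ε : ℝ) {δ δ' : ℝ}
    (hδ0 : 0 ≤ δ) (hδδ' : δ ≤ δ') (hne : (fmtSet (fun β' b => TypShellCondUKPc ρ β' b n ε δ) β).Nonempty) :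
    mixOnsetUc ρ β n ε δ' ≤ mixOnsetUc ρ β n ε δ :=
  fmtOnset_anti (fun β' b => TypShellCondUKPc ρ β' b n ε δ) (fun β' b => TypShellCondUKPc ρ β' b n ε δ') β
    (fun _ h => typShellCondUKPc_mono_delta hδ0 hδδ' h) hne

/-- **X transfers from a STRONGER format to a WEAKER one.**  If `P β b → Q β b` mesh by mesh (for `β ≥ β₀`) and `P` is
met at some mesh for every `β ≥ β₀`, then the X-clause for the onset of `P` implies the X-clause for the onset of `Q`
(`b⋆_Q ≤ b⋆_P` by `fmtOnset_anti`, so `T ≤ s · b⋆_Q` forces `T ≤ s · b⋆_P`). -/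
theorem afToOnset_clause_of_stronger_format (r : LatticeRep G) (P Q : ℝ → ℕ → Prop) {β₀ : ℝ}
    (hPQ : ∀ β : ℝ, β₀ ≤ β → ∀ b : ℕ, P β b → Q β b) (hne : ∀ β : ℝ, β₀ ≤ β → (fmtSet P β).Nonempty)
    (v : 𝓢(EuclideanSpace ℝ (Fin 4), ℝ)) (η : ℝ)
    (hX : ∃ T β₁ : ℝ, ∀ β : ℝ, β₁ ≤ β → ∀ s : ℝ, 0 < s → T ≤ s * (fmtOnset P β : ℝ) →
      ∃ᶠ (L : ℕ) in atTop, |Q2 G r β L s (thetaTest 4 v) v| ≤ η) :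
    ∃ T β₁ : ℝ, ∀ β : ℝ, β₁ ≤ β → ∀ s : ℝ, 0 < s → T ≤ s * (fmtOnset Q β : ℝ) →
      ∃ᶠ (L : ℕ) in atTop, |Q2 G r β L s (thetaTest 4 v) v| ≤ η := by
  obtain ⟨T, β₁, hT⟩ := hX
  refine ⟨T, max β₁ β₀, fun β hβ s hs hTs => ?_⟩
  have hβ1 : β₁ ≤ β := le_trans (le_max_left _ _) hβ
  have hβ0 : β₀ ≤ β := le_trans (le_max_right _ _) hβ
  have hanti : fmtOnset Q β ≤ fmtOnset P β := fmtOnset_anti P Q β (hPQ β hβ0) (hne β hβ0)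
  have hanti' : (fmtOnset Q β : ℝ) ≤ (fmtOnset P β : ℝ) := by exact_mod_cast hanti
  exact hT β hβ1 s hs (hTs.trans (mul_le_mul_of_nonneg_left hanti' hs.le))

/-- **The X-clause at a smaller budget implies it at a larger one** (`0 < δ ≤ δ'`), provided format Uc is met at budget
`δ` at some mesh for all large `β` (as `OnsetMixingTypicalUKPc` asserts for its `(n, ε)` and every `δ > 0`). -/
theorem afToOnsetUKPc_clause_mono_delta (r : LatticeRep G) (n : ℕ) (ε : ℝ) {δ δ' : ℝ} (hδ0 : 0 < δ)
    (hδδ' : δ ≤ δ') {β₀ : ℝ}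
    (hne : ∀ β : ℝ, β₀ ≤ β → (fmtSet (fun β' b => TypShellCondUKPc r.ρ β' b n ε δ) β).Nonempty)
    (v : 𝓢(EuclideanSpace ℝ (Fin 4), ℝ)) (η : ℝ)
    (hX : ∃ T β₁ : ℝ, ∀ β : ℝ, β₁ ≤ β → ∀ s : ℝ, 0 < s → T ≤ s * (mixOnsetUc r.ρ β n ε δ : ℝ) →
      ∃ᶠ (L : ℕ) in atTop, |Q2 G r β L s (thetaTest 4 v) v| ≤ η) :
    ∃ T β₁ : ℝ, ∀ β : ℝ, β₁ ≤ β → ∀ s : ℝ, 0 < s → T ≤ s * (mixOnsetUc r.ρ β n ε δ' : ℝ) →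
      ∃ᶠ (L : ℕ) in atTop, |Q2 G r β L s (thetaTest 4 v) v| ≤ η :=
  afToOnset_clause_of_stronger_format r (fun β' b => TypShellCondUKPc r.ρ β' b n ε δ)
    (fun β' b => TypShellCondUKPc r.ρ β' b n ε δ') (β₀ := β₀)
    (fun _ _ _ h => typShellCondUKPc_mono_delta hδ0.le hδδ' h) hne v η hX

/-- **Uc is stronger than the registered T format**, so the X-clause for `mixOnsetUc` implies the X-clause for the T
onset `fmtOnset (TypShellCond r.ρ · · n ε δ)` whenever format Uc is met at some mesh for all large `β`
(`typShellCond_of_UKPc` + `afToOnset_clause_of_stronger_format`). -/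
theorem afToOnset_clauseT_of_clauseUc (r : LatticeRep G) (n : ℕ) (ε δ : ℝ) {β₀ : ℝ}
    (hne : ∀ β : ℝ, β₀ ≤ β → (fmtSet (fun β' b => TypShellCondUKPc r.ρ β' b n ε δ) β).Nonempty)
    (v : 𝓢(EuclideanSpace ℝ (Fin 4), ℝ)) (η : ℝ)
    (hX : ∃ T β₁ : ℝ, ∀ β : ℝ, β₁ ≤ β → ∀ s : ℝ, 0 < s → T ≤ s * (mixOnsetUc r.ρ β n ε δ : ℝ) →
      ∃ᶠ (L : ℕ) in atTop, |Q2 G r β L s (thetaTest 4 v) v| ≤ η) :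
    ∃ T β₁ : ℝ, ∀ β : ℝ, β₁ ≤ β → ∀ s : ℝ, 0 < s →
      T ≤ s * (fmtOnset (fun β' b => OnsetFormats.TypShellCond r.ρ β' b n ε δ) β : ℝ) →
        ∃ᶠ (L : ℕ) in atTop, |Q2 G r β L s (thetaTest 4 v) v| ≤ η :=
  afToOnset_clause_of_stronger_format r (fun β' b => TypShellCondUKPc r.ρ β' b n ε δ)
    (fun β' b => OnsetFormats.TypShellCond r.ρ β' b n ε δ) (β₀ := β₀)
    (fun _ _ _ h => typShellCond_of_UKPc h) hne v η hX

/-! ### §X4 The kernel form of R66 for X: under a charged scalar centre the onset is `0` or eventually exceeds every bound -/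

/-- **`b⋆^c(β) = 0 ∨ B < b⋆^c(β)` eventually**, for a continuous faithful unitary `ρ` of degree `N ≥ 1` carrying a
central `g₀` as a scalar `c ≠ 1`, budgets `0 ≤ ε`, `16 ε < ‖1 − c‖`, `0 ≤ δ`, `4 · #windowCellsPlus(n) · δ < 1`, and every
bound `B` (the tree's fixed-mesh floor `FixedMesh.typOnsetFloor` read through `typShellCond_of_UKPc`: no mesh `≤ B` carries
format Uc for `β ≥ β₁(B)`, so the onset — the least such mesh, `0` if none — is `0` or `> B`).  Consequence: at such
parameter points the bounded-onset regime of §X1 is available ONLY through `b⋆^c = 0` (format unmet); wherever the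
supplier `stub_onsetUc` delivers the format, X^{Uc} is asked in the unbounded regime. -/
theorem mixOnsetUc_eq_zero_or_lt {N : ℕ} (ρ : G →* Matrix (Fin N) (Fin N) ℂ) (hρ : Continuous ρ)
    (hρi : Function.Injective ρ) (hρu : ∀ g, ρ g ∈ Matrix.unitaryGroup (Fin N) ℂ) (hN : 1 ≤ N)
    {g₀ : G} (hg : g₀ ∈ Subgroup.center G) {c : ℂ} (hρc : ρ g₀ = c • (1 : Matrix (Fin N) (Fin N) ℂ))
    (hc : c ≠ 1) (n : ℕ) {ε δ : ℝ} (hε0 : 0 ≤ ε) (hε : 16 * ε < ‖1 - c‖)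
    (hδ0 : 0 ≤ δ) (hδ : 4 * ((windowCellsPlus n).card : ℝ) * δ < 1) (B : ℕ) :
    ∃ β₁ : ℝ, ∀ β : ℝ, β₁ ≤ β → mixOnsetUc ρ β n ε δ = 0 ∨ B < mixOnsetUc ρ β n ε δ := by
  haveI : SecondCountableTopology G := (hρ.isClosedEmbedding hρi).isEmbedding.secondCountableTopology
  obtain ⟨β₁, hβ₁⟩ := FixedMesh.typOnsetFloor ρ hρ hρi hρu hN hg hρc hc n hε0 hε hδ0 hδ B
  refine ⟨β₁, fun β hβ => ?_⟩
  by_cases hne : (fmtSet (fun β' b => TypShellCondUKPc ρ β' b n ε δ) β).Nonempty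
  · right
    obtain ⟨hb1, hP⟩ := fmtOnset_spec (fun β' b => TypShellCondUKPc ρ β' b n ε δ) β hne
    by_contra hle
    rw [not_lt] at hle
    exact hβ₁ β hβ (mixOnsetUc ρ β n ε δ) hb1 hle (typShellCond_of_UKPc hP)
  · left
    rw [Set.not_nonempty_iff_eq_empty] at hne
    show sInf (fmtSet (fun β' b => TypShellCondUKPc ρ β' b n ε δ) β) = 0
    rw [hne, Nat.sInf_empty]

end XSide

end Summit.QuantumFields.YangMills.Cruxes.IR.AfPincerUc

end
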